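import Mathlib
import Summits.ValiantsHypothesis.ValiantsHypothesis.Theorems.LacunarySymmetroidMatrixDescartesDefiniteMomentsZones

/-!
# `MatrixDescartes` (stmt-ValiantsHypothesis-18050) — the DEFINITE-MOMENTS LAW, zones X: zone endpoints are determinant
# roots; `K − 1 ≤ Z₊ ≤ (K−1)·m` on the intrinsic hyperbolic sector

HONEST FRAMING.  Cell `pub-symmetroid`, seat `val-sym-mdr-p2` (gen 15); helper file `--supports` the crux
`Theses.LacunarySymmetroid.MatrixDescartes`, NO closure claim.  Structure of the sector of the lacunary Markus theorem
(`…DefiniteMomentsZones`); nothing here bears on the crux in its window, on `stub_twoSided`, on `DoorA26`/`DoorA34`,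
registers, or `VP ≠ VNP`.

CONTENT.  Rayleigh-sharp pencil `F(x) = ∑ₗ x^{dₗ}Sₗ` (`K ≥ 2` symmetric letters, strictly increasing exponents), zones
`Δᵢ = {ρᵢ(u) : u ≠ 0}` (`i < K − 1`) with root functions `ρ`.
* `mulVec_eq_zero_of_psd_of_form_eq_zero`: a symmetric matrix with non-negative quadratic form kills its isotropic vectors;
  `det_eq_zero_of_semidefinite_isotropic`: so a scale at which `c·F(x) ⪰ 0` (some `c ≠ 0`) with an isotropic non-zero vector
  is a determinant root.
* `det_eq_zero_at_zone_min` / `det_eq_zero_at_zone_max`: at `x = min Δᵢ` (resp. `max Δᵢ`), `σ(−1)ⁱF(x) ⪰ 0` (resp.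
  `σ(−1)^{i+1}F(x) ⪰ 0`) by the parity law and the pairwise zone order, with the extremal vector isotropic: BOTH ENDPOINTS
  OF EVERY ZONE ARE DETERMINANT ROOTS.
* `card_posRoots_ge_of_rayleighSharp`: for non-empty `ι`, `det F` has at least `K − 1` distinct positive zeros (the zone
  minima increase strictly) — with `card_posRoots_le_of_rayleighSharp`: `K − 1 ≤ Z₊ ≤ (K − 1)·card ι` on the sector.
[folklore]; axioms standard; no definitions.
-/

-- layout Summits/ValiantsHypothesis/ValiantsHypothesis forces the duplicated namespace component
set_option linter.dupNamespace false

namespace Summit.ValiantsHypothesis.ValiantsHypothesis.Theorems.LacunarySymmetroidMatrixDescartes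

open Polynomial Matrix Finset
open scoped BigOperators

namespace DefiniteMoments

section Endpoints

variable {ι : Type} [Fintype ι]

/-- **Isotropic vectors of a semidefinite form lie in the kernel.**  `A` symmetric real with `vᵀAv ≥ 0` for all `v`;
if `uᵀAu = 0` then `Au = 0`. [folklore] -/
theorem mulVec_eq_zero_of_psd_of_form_eq_zero (A : Matrix ι ι ℝ) (hA : A.IsSymm)
    (hpsd : ∀ v : ι → ℝ, 0 ≤ v ⬝ᵥ (A *ᵥ v)) (u : ι → ℝ) (hu : u ⬝ᵥ (A *ᵥ u) = 0) : A *ᵥ u = 0 := by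
  have hcross : ∀ w : ι → ℝ, u ⬝ᵥ (A *ᵥ w) = 0 := by
    intro w
    set c := u ⬝ᵥ (A *ᵥ w) with hc
    set q := w ⬝ᵥ (A *ᵥ w) with hq
    have hq0 : 0 ≤ q := hpsd w
    have hval : ∀ t : ℝ, 0 ≤ 2 * t * c + t ^ 2 * q := by
      intro t
      have h := hpsd ((1 : ℝ) • u + t • w)
      rw [form_plane A hA u w 1 t, hu] at h
      have e : (1 : ℝ) ^ 2 * 0 + 2 * 1 * t * (u ⬝ᵥ (A *ᵥ w)) + t ^ 2 * (w ⬝ᵥ (A *ᵥ w)) = 2 * t * c + t ^ 2 * q := by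
        rw [← hc, ← hq]; ring
      rw [e] at h
      exact h
    have hq1 : 0 < q + 1 := by linarith
    have h := hval (-c / (q + 1))
    have e : 2 * (-c / (q + 1)) * c + (-c / (q + 1)) ^ 2 * q = -(c ^ 2 * (q + 2)) / (q + 1) ^ 2 := by
      field_simp
      ring
    rw [e] at h
    have h' : 0 ≤ -(c ^ 2 * (q + 2)) := by
      have := mul_nonneg h (le_of_lt (pow_pos hq1 2))
      rwa [div_mul_cancel₀ _ (ne_of_gt (pow_pos hq1 2))] at this
    nlinarith [sq_nonneg c]
  have h := hcross (A *ᵥ u)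
  rw [← dotProduct_mulVec_symm A hA] at h
  exact dotProduct_self_eq_zero.1 h

/-- Scaling a matrix scales its quadratic form. [folklore] -/
theorem form_smul_matrix (c : ℝ) (A : Matrix ι ι ℝ) (v : ι → ℝ) : v ⬝ᵥ ((c • A) *ᵥ v) = c * (v ⬝ᵥ (A *ᵥ v)) := by
  rw [Matrix.smul_mulVec, dotProduct_smul, smul_eq_mul]

/-- **Semidefinite scale with an isotropic vector ⇒ determinant root.**  If `c ≠ 0`, `c·vᵀF(x)v ≥ 0` for all `v`, and
some `u ≠ 0` has `uᵀF(x)u = 0`, then `det F(x) = 0`. [folklore] -/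
theorem det_eq_zero_of_semidefinite_isotropic [DecidableEq ι] {K : ℕ} (d : Fin K → ℕ) (S : Fin K → Matrix ι ι ℝ)
    (hS : ∀ l, (S l).IsSymm) {x c : ℝ} (hc : c ≠ 0)
    (hpsd : ∀ v : ι → ℝ, 0 ≤ c * (v ⬝ᵥ ((∑ k, x ^ d k • S k) *ᵥ v))) (u : ι → ℝ) (hu : u ≠ 0)
    (hu0 : u ⬝ᵥ ((∑ k, x ^ d k • S k) *ᵥ u) = 0) : (∑ k, x ^ d k • S k).det = 0 := by
  set A := c • (∑ k, x ^ d k • S k) with hA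
  have hAs : A.IsSymm := (isSymm_eval d S hS x).smul _
  have hApsd : ∀ v : ι → ℝ, 0 ≤ v ⬝ᵥ (A *ᵥ v) := fun v => by rw [hA, form_smul_matrix]; exact hpsd v
  have hAu : u ⬝ᵥ (A *ᵥ u) = 0 := by rw [hA, form_smul_matrix, hu0, mul_zero]
  have hker := mulVec_eq_zero_of_psd_of_form_eq_zero A hAs hApsd u hAu
  rw [hA, Matrix.smul_mulVec] at hker
  exact Matrix.exists_mulVec_eq_zero_iff.1 ⟨u, hu, (smul_eq_zero.1 hker).resolve_left hc⟩

/-- The global sign of a Rayleigh-sharp pencil is non-zero (given a non-zero vector). [folklore] -/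
theorem sigma_ne_zero {K : ℕ} (hK : 2 ≤ K) (S : Fin K → Matrix ι ι ℝ) (σ : ℝ)
    (hσ : ∀ (l : Fin K) (v : ι → ℝ), v ≠ 0 → 0 < σ * (-1) ^ (l : ℕ) * (v ⬝ᵥ (S l *ᵥ v)))
    (u : ι → ℝ) (hu : u ≠ 0) : σ ≠ 0 := by
  intro h0
  have h := hσ ⟨0, by omega⟩ u hu
  rw [h0, zero_mul, zero_mul] at h
  exact lt_irrefl 0 h

/-- **The minimum of each zone is a determinant root.**  Rayleigh-sharp pencil (global sign `σ`, root functions `ρ`); if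
`um ≠ 0` minimises `ρ · i` over `{u ≠ 0}` then `det F(ρ um i) = 0`: at that scale `σ(−1)ⁱ vᵀFv ≥ 0` for every `v` (exactly
`i` roots of `P_v` lie below it, by the pairwise zone order) and `um` is isotropic. [folklore] -/
theorem det_eq_zero_at_zone_min [DecidableEq ι] {K : ℕ} (hK : 2 ≤ K) (d : Fin K → ℕ) (hd : StrictMono d)
    (S : Fin K → Matrix ι ι ℝ) (hS : ∀ l, (S l).IsSymm)
    (hsharp : ∀ v : ι → ℝ, v ≠ 0 →
      K ≤ ((∑ l, C (v ⬝ᵥ (S l *ᵥ v)) * (X : ℝ[X]) ^ d l).roots.toFinset.filter (fun t => 0 < t)).card + 1)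
    (σ : ℝ) (hσ : ∀ (l : Fin K) (v : ι → ℝ), v ≠ 0 → 0 < σ * (-1) ^ (l : ℕ) * (v ⬝ᵥ (S l *ᵥ v)))
    (ρ : (ι → ℝ) → Fin (K - 1) → ℝ)
    (hρ : ∀ u : ι → ℝ, u ≠ 0 → StrictMono (ρ u) ∧
      ∀ x : ℝ, x ∈ ((∑ l, C (u ⬝ᵥ (S l *ᵥ u)) * (X : ℝ[X]) ^ d l).roots.toFinset.filter (fun t => 0 < t))
        ↔ ∃ i, ρ u i = x)
    (i : Fin (K - 1)) (um : ι → ℝ) (hum : um ≠ 0) (hmin : ∀ u : ι → ℝ, u ≠ 0 → ρ um i ≤ ρ u i) :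
    (∑ k, ρ um i ^ d k • S k).det = 0 := by
  classical
  obtain ⟨hmono, hT⟩ := hρ um hum
  have hP0 := rayleighPoly_ne_zero_of_sharp hK d S hsharp um hum
  obtain ⟨hx0, hxform⟩ := (mem_posRoots_iff d S um hP0 _).1 ((hT (ρ um i)).2 ⟨i, rfl⟩)
  have hc : σ * (-1) ^ (i : ℕ) ≠ 0 := mul_ne_zero (sigma_ne_zero hK S σ hσ um hum) (pow_ne_zero _ (by norm_num))
  refine det_eq_zero_of_semidefinite_isotropic d S hS hc (fun v => ?_) um hum hxform
  by_cases hv : v = 0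
  · simp [hv]
  by_cases hroot : v ⬝ᵥ ((∑ k, ρ um i ^ d k • S k) *ᵥ v) = 0
  · rw [hroot, mul_zero]
  obtain ⟨hmv, hTv⟩ := hρ v hv
  have hnr : ¬ (∑ l, C (v ⬝ᵥ (S l *ᵥ v)) * (X : ℝ[X]) ^ d l).IsRoot (ρ um i) :=
    fun h => hroot ((isRoot_iff_form_eq_zero d S v _).1 h)
  have hsign := rayleigh_sign_law hK d hd S hsharp σ hσ v hv hx0 hnr
  have hcount : ((∑ l, C (v ⬝ᵥ (S l *ᵥ v)) * (X : ℝ[X]) ^ d l).roots.toFinset.filter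
      (fun t => 0 < t ∧ t < ρ um i)).card = i := by
    rw [rootsBelow_enum d S v (ρ v) hmv.injective hTv (ρ um i)]
    have e : (Finset.univ : Finset (Fin (K - 1))).filter (fun i' => ρ v i' < ρ um i) = Finset.Iio i := by
      ext i'
      simp only [Finset.mem_filter, Finset.mem_univ, true_and, Finset.mem_Iio]
      constructor
      · intro h
        exact hmv.lt_iff_lt.1 (h.trans_le (hmin v hv))
      · intro h
        have hi1 : (i' : ℕ) + 1 < K - 1 := by have := i.isLt; have := Fin.lt_def.1 h; omega
        have h1 := root_lt_root_succ hK d hd S hS hsharp σ hσ ρ hρ v um hv hum i' ⟨(i' : ℕ) + 1, hi1⟩ rfl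
        have h2 : ρ um ⟨(i' : ℕ) + 1, hi1⟩ ≤ ρ um i :=
          hmono.monotone (Fin.mk_le_of_le_val (by have := Fin.lt_def.1 h; omega))
        exact h1.trans_le h2
    rw [e, Fin.card_Iio]
  rw [hcount] at hsign
  exact hsign.le

/-- **The maximum of each zone is a determinant root.**  If `uM ≠ 0` maximises `ρ · i` over `{u ≠ 0}` then
`det F(ρ uM i) = 0` (there `σ(−1)^{i+1} F ⪰ 0` with `uM` isotropic). [folklore] -/
theorem det_eq_zero_at_zone_max [DecidableEq ι] {K : ℕ} (hK : 2 ≤ K) (d : Fin K → ℕ) (hd : StrictMono d)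
    (S : Fin K → Matrix ι ι ℝ) (hS : ∀ l, (S l).IsSymm)
    (hsharp : ∀ v : ι → ℝ, v ≠ 0 →
      K ≤ ((∑ l, C (v ⬝ᵥ (S l *ᵥ v)) * (X : ℝ[X]) ^ d l).roots.toFinset.filter (fun t => 0 < t)).card + 1)
    (σ : ℝ) (hσ : ∀ (l : Fin K) (v : ι → ℝ), v ≠ 0 → 0 < σ * (-1) ^ (l : ℕ) * (v ⬝ᵥ (S l *ᵥ v)))
    (ρ : (ι → ℝ) → Fin (K - 1) → ℝ)
    (hρ : ∀ u : ι → ℝ, u ≠ 0 → StrictMono (ρ u) ∧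
      ∀ x : ℝ, x ∈ ((∑ l, C (u ⬝ᵥ (S l *ᵥ u)) * (X : ℝ[X]) ^ d l).roots.toFinset.filter (fun t => 0 < t))
        ↔ ∃ i, ρ u i = x)
    (i : Fin (K - 1)) (uM : ι → ℝ) (huM : uM ≠ 0) (hmax : ∀ u : ι → ℝ, u ≠ 0 → ρ u i ≤ ρ uM i) :
    (∑ k, ρ uM i ^ d k • S k).det = 0 := by
  classical
  obtain ⟨hmono, hT⟩ := hρ uM huM
  have hP0 := rayleighPoly_ne_zero_of_sharp hK d S hsharp uM huM
  obtain ⟨hx0, hxform⟩ := (mem_posRoots_iff d S uM hP0 _).1 ((hT (ρ uM i)).2 ⟨i, rfl⟩)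
  have hc : σ * (-1) ^ ((i : ℕ) + 1) ≠ 0 :=
    mul_ne_zero (sigma_ne_zero hK S σ hσ uM huM) (pow_ne_zero _ (by norm_num))
  refine det_eq_zero_of_semidefinite_isotropic d S hS hc (fun v => ?_) uM huM hxform
  by_cases hv : v = 0
  · simp [hv]
  by_cases hroot : v ⬝ᵥ ((∑ k, ρ uM i ^ d k • S k) *ᵥ v) = 0
  · rw [hroot, mul_zero]
  obtain ⟨hmv, hTv⟩ := hρ v hv
  have hPv0 := rayleighPoly_ne_zero_of_sharp hK d S hsharp v hv
  have hnr : ¬ (∑ l, C (v ⬝ᵥ (S l *ᵥ v)) * (X : ℝ[X]) ^ d l).IsRoot (ρ uM i) :=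
    fun h => hroot ((isRoot_iff_form_eq_zero d S v _).1 h)
  have hsign := rayleigh_sign_law hK d hd S hsharp σ hσ v hv hx0 hnr
  have hcount : ((∑ l, C (v ⬝ᵥ (S l *ᵥ v)) * (X : ℝ[X]) ^ d l).roots.toFinset.filter
      (fun t => 0 < t ∧ t < ρ uM i)).card = (i : ℕ) + 1 := by
    rw [rootsBelow_enum d S v (ρ v) hmv.injective hTv (ρ uM i)]
    have e : (Finset.univ : Finset (Fin (K - 1))).filter (fun i' => ρ v i' < ρ uM i) = Finset.Iic i := by
      ext i'
      simp only [Finset.mem_filter, Finset.mem_univ, true_and, Finset.mem_Iic]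
      constructor
      · intro h
        by_contra hlt
        push Not at hlt
        have hi1 : (i : ℕ) + 1 < K - 1 := by have := i'.isLt; have := Fin.lt_def.1 hlt; omega
        have h1 := root_lt_root_succ hK d hd S hS hsharp σ hσ ρ hρ uM v huM hv i ⟨(i : ℕ) + 1, hi1⟩ rfl
        have h2 : ρ v ⟨(i : ℕ) + 1, hi1⟩ ≤ ρ v i' :=
          hmv.monotone (Fin.mk_le_of_le_val (by have := Fin.lt_def.1 hlt; omega))
        linarith
      · intro h
        have h1 : ρ v i' ≤ ρ uM i := (hmv.monotone h).trans (hmax v hv)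
        refine lt_of_le_of_ne h1 fun heq => ?_
        have hmem := (hTv (ρ uM i)).2 ⟨i', heq⟩
        exact hroot ((mem_posRoots_iff d S v hPv0 _).1 hmem).2
    rw [e, Fin.card_Iic]
  rw [hcount] at hsign
  exact hsign.le

/-- **At least `K − 1` positive determinant zeros on the sector.**  For non-empty `ι`, a Rayleigh-sharp pencil has at
least `K − 1` distinct positive determinant zeros: the zone minima, which increase strictly.  Together with
`card_posRoots_le_of_rayleighSharp`: `K − 1 ≤ Z₊ ≤ (K − 1)·card ι`. [folklore] -/
theorem card_posRoots_ge_of_rayleighSharp [Nonempty ι] [DecidableEq ι] {K : ℕ} (hK : 2 ≤ K) (d : Fin K → ℕ)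
    (hd : StrictMono d) (S : Fin K → Matrix ι ι ℝ) (hS : ∀ l, (S l).IsSymm)
    (hsharp : ∀ v : ι → ℝ, v ≠ 0 →
      K ≤ ((∑ l, C (v ⬝ᵥ (S l *ᵥ v)) * (X : ℝ[X]) ^ d l).roots.toFinset.filter (fun t => 0 < t)).card + 1) :
    K - 1 ≤ ((Matrix.det (∑ k, ((X : ℝ[X]) ^ d k) • (S k).map C)).roots.toFinset.filter (fun t => 0 < t)).card := by
  classical
  have hv₀ : (fun _ : ι => (1 : ℝ)) ≠ 0 := by
    intro h; have := congrFun h (Classical.arbitrary ι); simp at this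
  obtain ⟨σ, -, hσ⟩ := alternatingDefinite_of_rayleighSharp hK d hd S hsharp _ hv₀
  obtain ⟨ρ, hρ⟩ := exists_rootFn hK d S hsharp
  have hex : ∀ i : Fin (K - 1), ∃ um : ι → ℝ, um ≠ 0 ∧ ∀ u : ι → ℝ, u ≠ 0 → ρ um i ≤ ρ u i :=
    fun i => (exists_extremal_vectors hK d S hsharp ρ hρ i).2
  choose um hum hmin using hex
  -- the determinant polynomial is non-zero (it does not vanish at an alternating scale)
  set p := Matrix.det (∑ k, ((X : ℝ[X]) ^ d k) • (S k).map C) with hp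
  obtain ⟨a, σ', ha, ha0, -, hdef⟩ := exists_alternatingScales_of_rayleighSharp hK d hd S hS hsharp
  have hp0 : p ≠ 0 := by
    intro h0
    have hdet : (∑ k, a 0 ^ d k • S k).det = 0 := by rw [← eval_det_pencil, ← hp, h0, Polynomial.eval_zero]
    obtain ⟨v, hv, hFv⟩ := Matrix.exists_mulVec_eq_zero_iff.2 hdet
    have h := hdef 0 v hv
    rw [hFv, dotProduct_zero, mul_zero] at h
    exact lt_irrefl 0 h
  -- the zone minima are distinct positive roots
  set z : Fin (K - 1) → ℝ := fun i => ρ (um i) i with hz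
  have hzmono : StrictMono z := by
    intro i j hij
    simp only [hz]
    exact (hmin i (um j) (hum j)).trans_lt ((hρ (um j) (hum j)).1 hij)
  have hsub : Finset.univ.image z ⊆ p.roots.toFinset.filter (fun t => 0 < t) := by
    intro x hx
    obtain ⟨i, -, rfl⟩ := Finset.mem_image.1 hx
    have hP0 := rayleighPoly_ne_zero_of_sharp hK d S hsharp (um i) (hum i)
    have hpos : 0 < z i :=
      ((mem_posRoots_iff d S (um i) hP0 _).1 (((hρ (um i) (hum i)).2 _).2 ⟨i, rfl⟩)).1
    rw [Finset.mem_filter, Multiset.mem_toFinset, mem_roots hp0, Polynomial.IsRoot, hp, eval_det_pencil]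
    exact ⟨det_eq_zero_at_zone_min hK d hd S hS hsharp σ hσ ρ hρ i (um i) (hum i) (hmin i), hpos⟩
  have h := Finset.card_le_card hsub
  rwa [Finset.card_image_of_injective _ hzmono.injective, Finset.card_univ, Fintype.card_fin] at h

end Endpoints

end DefiniteMoments

end Summit.ValiantsHypothesis.ValiantsHypothesis.Theorems.LacunarySymmetroidMatrixDescartes
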